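import Summits.BirchSwinnertonDyer.BirchSwinnertonDyer.Theorems.BiquadraticEisensteinDescentHeegnerTwistCouplingInSupplySqrtTwoCellFifteen
import HarnessLib

set_option linter.dupNamespace false -- `Summit.BirchSwinnertonDyer.BirchSwinnertonDyer.Theorems.…` (summit = sub)
set_option autoImplicit false

/-!
# Crux `HeegnerTwistCouplingInSupply` (stmt-BirchSwinnertonDyer-21381) — card `sqrt2-isogeny-heegner-pin`, the THIRD CELL (prime twists):
# `B_{−pℓ} : y² = x³ − 4pℓ x² + 2p²ℓ² x` (`j = 8000`) with `p ≡ 5 (mod 8)` prime, `ℓ ≡ 7 (mod 8)` prime, `x⁴ − 4x² + 2` rootless mod `ℓ`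
# (every `ℓ ≢ ±1 (mod 16)`) and `(p/ℓ) = +1`: `S^{(φ̂)}, S^{(φ)} ⊆ {1, 2}`, `rank = 0`, `Ш[2] = 0`, `corank_{ℤ₂} Sel_{2^∞} = 0` — UNCONDITIONAL

Route `BiquadraticEisensteinDescent` (cell `pub/bsd-wall`, width seat `bsd-wall-cm-bed-w2` g12; `--supports` 21381, helper). The card's
data (e) — «family B with prime twists ℓ ≡ 7 (16), p ≢ 7 (16): 63/63 clean (conjectural third cell, no proof offered)» — is a theorem: the
mod-16 law read BACKWARDS. If `x⁴ − 4x² + 2` is ROOTLESS in a field (`2 ± √2` non-squares; for `𝔽_ℓ` this is `ℓ ≢ ±1 (mod 16)`, supplied here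
as a hypothesis and discharged per rung by `decide`) and `c = y²` is a nonzero square, then `t⁴ − 4ct² + 2c²` is rootless (`t ↦ t/y`). With
`m = pℓ` and `(p/ℓ) = +1` (so `c = p` is a square mod `ℓ`), the `ℓ`-divisible classes of both Selmer sets die at `ℓ`, the `p`-divisible ones
at `p` by the `(2/p) = −1` law (`p ≡ 5 (8)`; `…SqrtTwoCell.not_isSoluble_padic_of_prime_factor`), and `ℓ, 2ℓ` on the `φ`-side at `2`
(`ℓ ≡ 7 (8)`; `…CellFifteenLocal.not_isSoluble_two_p_and_two_p`). For `W = B_p`, `p ≡ 5 (mod 8)`, the Heegner condition on `K′ = ℚ(√−ℓ)` is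
`(−ℓ/p) = (p/ℓ) = +1` — EXACTLY the cell condition — so fixed small `ℓ₀ ∈ {7, 23, 71, …}` give pin-free rungs (`…SqrtTwoCornerSeven`).

* §1 `rootless_of_sq` (backwards law), `not_isSoluble_padic_hat_at_ell` (`φ̂`-classes `ℓ, 2ℓ`; reduced quartics `t⁴ − 4ct² + 2c²`,
  `2t⁴ − 4ct² + c²` via `t ↦ √2·t`, `2` being a square mod `ℓ ≡ 7 (8)`), `not_isSoluble_padic_prime_at_ell` (`φ`-classes `−ℓ, −2ℓ`; square
  parameters `2c = (√2·y)²` and `c`);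
* §2 `mem_twoIsogenySelmerGroup_phiHat` / `…_phi`: **`S(−4m, 2m²) ⊆ {1, 2}`**, **`S(8m, 8m²) ⊆ {1, 2}`** for `m = pℓ`;
* §3 ★ `rank_eq_zero_and_sha_two` — **`rank B_{−pℓ}(ℚ) = 0` and `Ш(B_{−pℓ}/ℚ)[2] = 0`**; ★ `selmerCorank_two_eq_zero` — **`corank₂ = 0`**.

HONEST FRAMING: unconditional arithmetic of one explicit CM family; nothing about `L`-values here; the crux (all CM `W` of analytic rank one;
residual C⁺) and BSD are NOT proved by any of this. THEOREMS ONLY; supports stmt-BirchSwinnertonDyer-21381.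
-/

noncomputable section

open scoped Classical

namespace Summit.BirchSwinnertonDyer.BirchSwinnertonDyer.Theorems.BiquadraticEisensteinDescentHeegnerTwistCouplingInSupplySqrtTwoCellSeven

open _root_.WeierstrassCurve Literature.NumberTheory.EllipticCurves
open Summit.BirchSwinnertonDyer.BirchSwinnertonDyer.Theorems.GoldfeldGoodTwists (mordellWeilRank_congr forall_mem_sha_two_congr)
open Summit.BirchSwinnertonDyer.BirchSwinnertonDyer.Theorems.BiquadraticEisensteinDescentHeegnerTwistCouplingInSupplySqrtTwoCell
open Summit.BirchSwinnertonDyer.BirchSwinnertonDyer.Theorems.BiquadraticEisensteinDescentHeegnerTwistCouplingInSupplySqrtTwoCellFifteenLocal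
  (not_isSoluble_padic_of_dvd_of_rootless rootless_both_of_rootless not_isSoluble_two_p_and_two_p)
open Summit.BirchSwinnertonDyer.BirchSwinnertonDyer.Theorems.BiquadraticEisensteinDescentHeegnerTwistCouplingInSupplySqrtTwoCellFifteen
  (false_of_neg_of_isLocallySoluble eq_of_squarefree_of_prime_factors dvd_of_dvd_mul_prime)

/-! ## §1 The mod-16 law read backwards: `x⁴ − 4x² + 2` rootless and `c` a square ⇒ `t⁴ − 4ct² + 2c²` rootless -/

section Local

/-- **Backwards `2 ± √2` law.** In a field, if `x⁴ − 4x² + 2` has no root and `c = y²` with `y ≠ 0`, then `t⁴ − 4c t² + 2c²` has no root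
(`t ↦ t/y` scales one equation to the other). For a prime `ℓ ≡ 7 (mod 16)` the hypothesis holds (`2 ± √2` are non-squares); per rung it
is checked by `decide`. [folklore] -/
theorem rootless_of_sq {F : Type*} [Field F] (hroot : ∀ x : F, x ^ 4 - 4 * x ^ 2 + 2 ≠ 0) {c y : F} (hc : c = y ^ 2) (hy : y ≠ 0)
    (t : F) : t ^ 4 - 4 * c * t ^ 2 + 2 * c ^ 2 ≠ 0 := by
  intro ht
  apply hroot (t / y)
  have hy4 : y ^ 4 ≠ 0 := pow_ne_zero 4 hy
  have key : (t / y) ^ 4 - 4 * (t / y) ^ 2 + 2 = (t ^ 4 - 4 * c * t ^ 2 + 2 * c ^ 2) / y ^ 4 := by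
    rw [hc, eq_div_iff hy4]; field_simp
  rw [key, ht, zero_div]

variable {ℓ : ℕ} [Fact ℓ.Prime]

/-- **At the twisting prime `ℓ`, `φ̂`-side classes `d = ℓ, 2ℓ`**: for `m = ℓ c` with `c` a nonzero SQUARE mod `ℓ`, `2` a square mod `ℓ`
and `x⁴ − 4x² + 2` rootless mod `ℓ`, the spaces `w² = ℓ u⁴ − 4m u²z² + 2ℓc² z⁴` and `w² = 2ℓ u⁴ − 4m u²z² + ℓc² z⁴` have no `ℚ_ℓ`-point
(reduced quartics `t⁴ − 4ct² + 2c²` and `2t⁴ − 4ct² + c²`, the latter via `t ↦ √2·t`). [cite: SilvermanAEC2009, Prop. X.4.9 (local conditions on C_d)] -/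
theorem not_isSoluble_padic_hat_at_ell (hroot : ∀ x : ZMod ℓ, x ^ 4 - 4 * x ^ 2 + 2 ≠ 0) (h2 : IsSquare (2 : ZMod ℓ))
    {m c : ℤ} (hm : m = ℓ * c) (hc : IsSquare (c : ZMod ℓ)) (hc0 : (c : ZMod ℓ) ≠ 0) :
    ¬ ((twoIsogenyQuartic (-4 * m) ℓ (2 * ℓ * c ^ 2)).map (Int.castRingHom ℚ_[ℓ])).IsSoluble ∧
      ¬ ((twoIsogenyQuartic (-4 * m) (2 * ℓ) (ℓ * c ^ 2)).map (Int.castRingHom ℚ_[ℓ])).IsSoluble := by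
  obtain ⟨y, hy⟩ := hc
  have hy0 : y ≠ 0 := by rintro rfl; exact hc0 (by rw [hy, mul_zero])
  have hc' : (c : ZMod ℓ) = y ^ 2 := by rw [hy, pow_two]
  obtain ⟨s, hs⟩ := h2
  have hs2 : s ^ 2 = 2 := by rw [pow_two, ← hs]
  have h20 : (2 : ZMod ℓ) ≠ 0 := fun h0 => hroot 0 (by rw [h0]; ring)
  constructor
  · refine not_isSoluble_padic_of_dvd_of_rootless (A₁ := -4 * c) (d₁ := 1) (e₁ := 2 * c ^ 2)
      (by rw [hm]; ring) (by ring) (by ring) (rootless_both_of_rootless (by norm_num) fun t ht => ?_)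
    push_cast at ht
    exact rootless_of_sq hroot hc' hy0 t (by linear_combination ht)
  · refine not_isSoluble_padic_of_dvd_of_rootless (A₁ := -4 * c) (d₁ := 2) (e₁ := c ^ 2)
      (by rw [hm]; ring) (by ring) (by ring) (rootless_both_of_rootless (by exact_mod_cast h20) fun t ht => ?_)
    push_cast at ht
    exact rootless_of_sq hroot hc' hy0 (s * t) (by linear_combination 2 * ht + (t ^ 4 * (s ^ 2 + 2) - 4 * (c : ZMod ℓ) * t ^ 2) * hs2)

/-- **At the twisting prime `ℓ`, `φ`-side classes `d = −ℓ, −2ℓ`** (same hypotheses): `w² = −ℓ u⁴ + 8m u²z² − 8ℓc² z⁴` and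
`w² = −2ℓ u⁴ + 8m u²z² − 4ℓc² z⁴` have no `ℚ_ℓ`-point (reduced quartics `−t⁴ + 8ct² − 8c²` — square parameter `2c = (√2·y)²` — and
`−2t⁴ + 8ct² − 4c²`). [cite: SilvermanAEC2009, Prop. X.4.9 (local conditions on C_d)] -/
theorem not_isSoluble_padic_prime_at_ell (hroot : ∀ x : ZMod ℓ, x ^ 4 - 4 * x ^ 2 + 2 ≠ 0) (h2 : IsSquare (2 : ZMod ℓ))
    {m c : ℤ} (hm : m = ℓ * c) (hc : IsSquare (c : ZMod ℓ)) (hc0 : (c : ZMod ℓ) ≠ 0) :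
    ¬ ((twoIsogenyQuartic (8 * m) (-ℓ) (-(8 * ℓ * c ^ 2))).map (Int.castRingHom ℚ_[ℓ])).IsSoluble ∧
      ¬ ((twoIsogenyQuartic (8 * m) (-(2 * ℓ)) (-(4 * ℓ * c ^ 2))).map (Int.castRingHom ℚ_[ℓ])).IsSoluble := by
  obtain ⟨y, hy⟩ := hc
  have hy0 : y ≠ 0 := by rintro rfl; exact hc0 (by rw [hy, mul_zero])
  have hc' : (c : ZMod ℓ) = y ^ 2 := by rw [hy, pow_two]
  obtain ⟨s, hs⟩ := h2
  have hs2 : s ^ 2 = 2 := by rw [pow_two, ← hs]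
  have h20 : (2 : ZMod ℓ) ≠ 0 := fun h0 => hroot 0 (by rw [h0]; ring)
  have hs0 : s ≠ 0 := by rintro rfl; exact h20 (by rw [← hs2]; ring)
  constructor
  · refine not_isSoluble_padic_of_dvd_of_rootless (A₁ := 8 * c) (d₁ := -1) (e₁ := -(8 * c ^ 2))
      (by rw [hm]; ring) (by ring) (by ring)
      (rootless_both_of_rootless (by push_cast; exact neg_ne_zero.mpr one_ne_zero) fun t ht => ?_)
    push_cast at ht
    exact rootless_of_sq hroot (c := 2 * (c : ZMod ℓ)) (y := s * y) (by rw [hc', mul_pow, hs2]) (mul_ne_zero hs0 hy0) t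
      (by linear_combination (-1) * ht)
  · refine not_isSoluble_padic_of_dvd_of_rootless (A₁ := 8 * c) (d₁ := -2) (e₁ := -(4 * c ^ 2))
      (by rw [hm]; ring) (by ring) (by ring)
      (rootless_both_of_rootless (by push_cast; exact neg_ne_zero.mpr h20) fun t ht => ?_)
    push_cast at ht
    have h2inv : (2 : ZMod ℓ)⁻¹ * 2 = 1 := inv_mul_cancel₀ h20
    exact rootless_of_sq hroot hc' hy0 t
      (by linear_combination (-(2 : ZMod ℓ)⁻¹) * ht - (t ^ 4 - 4 * (c : ZMod ℓ) * t ^ 2 + 2 * (c : ZMod ℓ) ^ 2) * h2inv)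

end Local

/-! ## §2 The two Selmer sets of `B_{−pℓ}`: `S(−4m, 2m²) ⊆ {1, 2}` and `S(8m, 8m²) ⊆ {1, 2}` (`m = pℓ`) -/

section Selmer

variable {p ℓ : ℕ} {m : ℤ}

/-- `m = pℓ` is positive, square-free and odd; `p ≠ ℓ`. [folklore] -/
theorem pos_squarefree_odd (hp : p.Prime) (hp8 : p % 8 = 5) (hℓ : ℓ.Prime) (hℓ8 : ℓ % 8 = 7) (hm : m = p * ℓ) :
    0 < m ∧ Squarefree m ∧ Odd m ∧ p ≠ ℓ := by
  have hpl : p ≠ ℓ := by rintro rfl; omega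
  refine ⟨by rw [hm]; have := hp.pos; have := hℓ.pos; positivity, ?_, ?_, hpl⟩
  · rw [hm, ← Int.squarefree_natAbs, Int.natAbs_mul, Int.natAbs_natCast, Int.natAbs_natCast,
      Nat.squarefree_mul ((Nat.coprime_primes hp hℓ).mpr hpl)]
    exact ⟨hp.squarefree, hℓ.squarefree⟩
  · rw [hm]
    exact (Int.odd_iff.mpr (by omega)).mul (Int.odd_iff.mpr (by omega))

/-- **CELL-7, `φ̂`-side: `S(−4m, 2m²) ⊆ {1, 2}`** for `m = pℓ`, `p ≡ 5 (mod 8)` prime, `ℓ ≡ 7 (mod 8)` prime with `x⁴ − 4x² + 2` rootless mod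
`ℓ` and `(p/ℓ) = +1`: classes divisible by `p` die `p`-adically (`(2/p) = −1`, `…SqrtTwoCell.not_isSoluble_padic_of_prime_factor`), `ℓ, 2ℓ`
die `ℓ`-adically (backwards `2 ± √2` law, `c = p` a square mod `ℓ`), negative classes die over `ℝ`.
[cite: SilvermanAEC2009, Prop. X.4.9 and Remark X.4.9.1] -/
theorem mem_twoIsogenySelmerGroup_phiHat (hp : p.Prime) (hp8 : p % 8 = 5) (hℓ : ℓ.Prime) (hℓ8 : ℓ % 8 = 7)
    (hroot : ∀ x : ZMod ℓ, x ^ 4 - 4 * x ^ 2 + 2 ≠ 0) (hsq : IsSquare (p : ZMod ℓ)) (hm : m = p * ℓ) {d : ℤ}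
    (h : d ∈ twoIsogenySelmerGroup (-4 * m) (2 * m ^ 2)) : d = 1 ∨ d = 2 := by
  haveI : Fact p.Prime := ⟨hp⟩
  haveI : Fact ℓ.Prime := ⟨hℓ⟩
  obtain ⟨hm0, hmsq, -, hpl⟩ := pos_squarefree_odd hp hp8 hℓ hℓ8 hm
  have hℓ0 : (ℓ : ℤ) ≠ 0 := by exact_mod_cast hℓ.ne_zero
  have hb : (2 * m ^ 2 : ℤ) ≠ 0 := by positivity
  obtain ⟨hsqd, hdvd, hloc⟩ := (mem_twoIsogenySelmerGroup_iff hb).mp h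
  by_cases hpd : (p : ℤ) ∣ d
  · exfalso
    exact not_isSoluble_padic_of_prime_factor (r := p) (Or.inr hp8) (α := -4) (β := 2) (c := 2) (by norm_num)
      (by simpa using not_dvd_two_pow_of_odd_prime hp (by rintro rfl; omega) (k := 1)) hmsq (by rw [hm]; exact dvd_mul_right _ _)
      hsqd hpd hdvd (by simpa [neg_mul] using hloc.2 p)
  · have hfac : ∀ q : ℕ, q.Prime → (q : ℤ) ∣ d → q = 2 ∨ q = ℓ := fun q hq hqd => by
      by_cases hq2 : q = 2
      · exact Or.inl hq2
      · have hqm : (q : ℤ) ∣ m := dvd_of_prime_dvd_of_dvd_mul_sq hq hq2 (Or.inl rfl) hqd hdvd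
        rw [hm] at hqm
        rcases (Nat.prime_iff_prime_int.mp hq).dvd_or_dvd hqm with h1 | h1
        · exact absurd (((Nat.prime_dvd_prime_iff_eq hq hp).mp (Int.natCast_dvd_natCast.mp h1)) ▸ hqd) hpd
        · exact Or.inr ((Nat.prime_dvd_prime_iff_eq hq hℓ).mp (Int.natCast_dvd_natCast.mp h1))
    by_cases hℓd : (ℓ : ℤ) ∣ d
    · have hc0 : ((p : ℤ) : ZMod ℓ) ≠ 0 := by
        rw [Ne, ZMod.intCast_zmod_eq_zero_iff_dvd, Int.natCast_dvd_natCast]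
        exact fun h1 => hpl ((Nat.prime_dvd_prime_iff_eq hℓ hp).mp h1).symm
      obtain ⟨h1, h2⟩ := not_isSoluble_padic_hat_at_ell hroot ((ZMod.exists_sq_eq_two_iff (by rintro rfl; omega)).mpr (Or.inr hℓ8))
        (m := m) (c := p) (by rw [hm]; ring) (by exact_mod_cast hsq) hc0
      rcases eq_of_squarefree_of_prime_factors hℓ hsqd hℓd hfac with rfl | rfl | rfl | rfl
      · exfalso; refine h1 ?_
        have := hloc.2 ℓ
        rwa [show (2 * m ^ 2 : ℤ) / ℓ = 2 * ℓ * (p : ℤ) ^ 2 by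
          rw [show (2 * m ^ 2 : ℤ) = ℓ * (2 * ℓ * (p : ℤ) ^ 2) by rw [hm]; ring]
          exact Int.mul_ediv_cancel_left _ hℓ0] at this
      · exfalso; refine h2 ?_
        have := hloc.2 ℓ
        rwa [show (2 * m ^ 2 : ℤ) / (2 * ℓ) = ℓ * (p : ℤ) ^ 2 by
          rw [show (2 * m ^ 2 : ℤ) = (2 * ℓ) * (ℓ * (p : ℤ) ^ 2) by rw [hm]; ring]
          exact Int.mul_ediv_cancel_left _ (mul_ne_zero two_ne_zero hℓ0)] at this
      · exact (false_of_neg_of_isLocallySoluble hm0 (by simp [hℓ.pos]) hdvd hloc).elim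
      · exact (false_of_neg_of_isLocallySoluble hm0 (by simp [hℓ.pos]) hdvd hloc).elim
    · have habs := natAbs_eq_one_or_two_of_squarefree hsqd fun q hq hqd => by
        rcases hfac q hq hqd with h2 | hl
        · exact h2
        · exact absurd (hl ▸ hqd) hℓd
      rcases Int.natAbs_eq d with hpos | hneg
      · rcases habs with h1 | h2 <;> omega
      · exact (false_of_neg_of_isLocallySoluble hm0 (by rcases habs with h1 | h2 <;> omega) hdvd hloc).elim

/-- **CELL-7, `φ`-side: `S(8m, 8m²) ⊆ {1, 2}`** (same hypotheses): classes divisible by `p` die `p`-adically, `−ℓ, −2ℓ` die `ℓ`-adically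
(backwards law with square parameters `2p`, `p`), `ℓ, 2ℓ` die `2`-adically (`ℓ ≡ 7 (mod 8)`), `−1, −2` die `2`-adically (`m` odd).
[cite: SilvermanAEC2009, Prop. X.4.9] -/
theorem mem_twoIsogenySelmerGroup_phi (hp : p.Prime) (hp8 : p % 8 = 5) (hℓ : ℓ.Prime) (hℓ8 : ℓ % 8 = 7)
    (hroot : ∀ x : ZMod ℓ, x ^ 4 - 4 * x ^ 2 + 2 ≠ 0) (hsq : IsSquare (p : ZMod ℓ)) (hm : m = p * ℓ) {d : ℤ}
    (h : d ∈ twoIsogenySelmerGroup (8 * m) (8 * m ^ 2)) : d = 1 ∨ d = 2 := by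
  haveI : Fact p.Prime := ⟨hp⟩
  haveI : Fact ℓ.Prime := ⟨hℓ⟩
  haveI : Fact (Nat.Prime 2) := ⟨Nat.prime_two⟩
  obtain ⟨hm0, hmsq, hmodd, hpl⟩ := pos_squarefree_odd hp hp8 hℓ hℓ8 hm
  have hℓ0 : (ℓ : ℤ) ≠ 0 := by exact_mod_cast hℓ.ne_zero
  have hb : (8 * m ^ 2 : ℤ) ≠ 0 := by positivity
  obtain ⟨hsqd, hdvd, hloc⟩ := (mem_twoIsogenySelmerGroup_iff hb).mp h
  by_cases hpd : (p : ℤ) ∣ d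
  · exfalso
    exact not_isSoluble_padic_of_prime_factor (r := p) (Or.inr hp8) (α := 8) (β := 8) (c := 4) (by norm_num)
      (by simpa using not_dvd_two_pow_of_odd_prime hp (by rintro rfl; omega) (k := 2)) hmsq (by rw [hm]; exact dvd_mul_right _ _)
      hsqd hpd hdvd (hloc.2 p)
  · have hfac : ∀ q : ℕ, q.Prime → (q : ℤ) ∣ d → q = 2 ∨ q = ℓ := fun q hq hqd => by
      by_cases hq2 : q = 2
      · exact Or.inl hq2
      · have hqm : (q : ℤ) ∣ m := dvd_of_prime_dvd_of_dvd_mul_sq hq hq2 (Or.inr rfl) hqd hdvd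
        rw [hm] at hqm
        rcases (Nat.prime_iff_prime_int.mp hq).dvd_or_dvd hqm with h1 | h1
        · exact absurd (((Nat.prime_dvd_prime_iff_eq hq hp).mp (Int.natCast_dvd_natCast.mp h1)) ▸ hqd) hpd
        · exact Or.inr ((Nat.prime_dvd_prime_iff_eq hq hℓ).mp (Int.natCast_dvd_natCast.mp h1))
    by_cases hℓd : (ℓ : ℤ) ∣ d
    · have hc0 : ((p : ℤ) : ZMod ℓ) ≠ 0 := by
        rw [Ne, ZMod.intCast_zmod_eq_zero_iff_dvd, Int.natCast_dvd_natCast]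
        exact fun h1 => hpl ((Nat.prime_dvd_prime_iff_eq hℓ hp).mp h1).symm
      obtain ⟨h1, h2⟩ := not_isSoluble_padic_prime_at_ell hroot ((ZMod.exists_sq_eq_two_iff (by rintro rfl; omega)).mpr (Or.inr hℓ8))
        (m := m) (c := p) (by rw [hm]; ring) (by exact_mod_cast hsq) hc0
      obtain ⟨h3, h4⟩ := not_isSoluble_two_p_and_two_p (p := (ℓ : ℤ)) (m := m) (m' := (p : ℤ)) (by omega) (by rw [hm]; ring)
        (Int.odd_iff.mpr (by omega))
      have e8 : (8 * m ^ 2 : ℤ) / ℓ = 8 * ℓ * (p : ℤ) ^ 2 := by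
        rw [show (8 * m ^ 2 : ℤ) = ℓ * (8 * ℓ * (p : ℤ) ^ 2) by rw [hm]; ring]
        exact Int.mul_ediv_cancel_left _ hℓ0
      have e4 : (8 * m ^ 2 : ℤ) / (2 * ℓ) = 4 * ℓ * (p : ℤ) ^ 2 := by
        rw [show (8 * m ^ 2 : ℤ) = (2 * ℓ) * (4 * ℓ * (p : ℤ) ^ 2) by rw [hm]; ring]
        exact Int.mul_ediv_cancel_left _ (mul_ne_zero two_ne_zero hℓ0)
      rcases eq_of_squarefree_of_prime_factors hℓ hsqd hℓd hfac with rfl | rfl | rfl | rfl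
      · exact (h3 (by simpa only [e8] using hloc.2 2)).elim
      · exact (h4 (by simpa only [e4] using hloc.2 2)).elim
      · exact (h1 (by simpa only [Int.ediv_neg, e8] using hloc.2 ℓ)).elim
      · exact (h2 (by simpa only [Int.ediv_neg, e4] using hloc.2 ℓ)).elim
    · have habs := natAbs_eq_one_or_two_of_squarefree hsqd fun q hq hqd => by
        rcases hfac q hq hqd with h2 | hl
        · exact h2
        · exact absurd (hl ▸ hqd) hℓd
      rcases Int.natAbs_eq d with hpos | hneg
      · rcases habs with h1 | h2 <;> omega
      · exfalso
        rcases habs with h1 | h2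
        · have hd1 : d = -1 := by omega
          subst hd1
          have h2' := hloc.2 2
          rw [Int.ediv_neg, Int.ediv_one] at h2'
          exact not_isSoluble_two_neg_one hmodd h2'
        · have hd2 : d = -2 := by omega
          subst hd2
          have h2' := hloc.2 2
          rw [Int.ediv_neg, show (8 * m ^ 2 : ℤ) = 2 * (4 * m ^ 2) by ring,
            Int.mul_ediv_cancel_left _ (two_ne_zero)] at h2'
          exact not_isSoluble_two_neg_two hmodd h2'

/-- `#S(−4m, 2m²) ≤ 2` on CELL-7. [cite: SilvermanAEC2009, Prop. X.4.9] -/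
theorem card_twoIsogenySelmerGroup_le (hp : p.Prime) (hp8 : p % 8 = 5) (hℓ : ℓ.Prime) (hℓ8 : ℓ % 8 = 7)
    (hroot : ∀ x : ZMod ℓ, x ^ 4 - 4 * x ^ 2 + 2 ≠ 0) (hsq : IsSquare (p : ZMod ℓ)) (hm : m = p * ℓ) :
    (twoIsogenySelmerGroup (-4 * m) (2 * m ^ 2)).card ≤ 2 :=
  le_trans (Finset.card_le_card fun d hd => by
    have := mem_twoIsogenySelmerGroup_phiHat hp hp8 hℓ hℓ8 hroot hsq hm hd
    simp only [Finset.mem_insert, Finset.mem_singleton]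
    exact this) (Finset.card_le_two (a := (1 : ℤ)) (b := 2))

/-- `#S′(−4m, 2m²) = #S(8m, 8m²) ≤ 2` on CELL-7. [cite: SilvermanAEC2009, Prop. X.4.9] -/
theorem card_twoIsogenySelmerGroup'_le (hp : p.Prime) (hp8 : p % 8 = 5) (hℓ : ℓ.Prime) (hℓ8 : ℓ % 8 = 7)
    (hroot : ∀ x : ZMod ℓ, x ^ 4 - 4 * x ^ 2 + 2 ≠ 0) (hsq : IsSquare (p : ZMod ℓ)) (hm : m = p * ℓ) :
    (twoIsogenySelmerGroup' (-4 * m) (2 * m ^ 2)).card ≤ 2 := by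
  rw [twoIsogenySelmerGroup'_B]
  exact le_trans (Finset.card_le_card fun d hd => by
    have := mem_twoIsogenySelmerGroup_phi hp hp8 hℓ hℓ8 hroot hsq hm hd
    simp only [Finset.mem_insert, Finset.mem_singleton]
    exact this) (Finset.card_le_two (a := (1 : ℤ)) (b := 2))

end Selmer

/-! ## §3 `rank B_{−pℓ}(ℚ) = 0`, `Ш(B_{−pℓ}/ℚ)[2] = 0`, `corank_{ℤ₂} Sel_{2^∞}(B_{−pℓ}/ℚ) = 0` on CELL-7 -/

section RankZero

variable {p ℓ : ℕ} {m : ℤ}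

/-- Arithmetic core: `2^{r+2}·(n₁ n₂) ≤ 4` with the product positive forces `r = 0`, `n₁ = n₂ = 1`. [folklore] -/
private theorem rank_zero_arith {r n₁ n₂ : ℕ} (h4 : 2 ^ (r + 2) * (n₁ * n₂) ≤ 4) (hpos : 0 < 2 ^ (r + 2) * (n₁ * n₂)) :
    r = 0 ∧ n₁ = 1 ∧ n₂ = 1 := by
  have hn : 0 < n₁ * n₂ := Nat.pos_of_ne_zero (by rintro h0; rw [h0, mul_zero] at hpos; exact lt_irrefl 0 hpos)
  have hn₁ : 0 < n₁ := Nat.pos_of_ne_zero (by rintro rfl; simp at hn)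
  have hn₂ : 0 < n₂ := Nat.pos_of_ne_zero (by rintro rfl; simp at hn)
  have h2 : 2 ^ (r + 2) ≤ 4 := le_trans (Nat.le_mul_of_pos_right _ hn) h4
  have hr : r = 0 := by
    by_contra hr
    have h8 : 2 ^ 3 ≤ 2 ^ (r + 2) := Nat.pow_le_pow_right (by norm_num) (by omega)
    omega
  subst hr
  norm_num at h4
  refine ⟨rfl, ?_, ?_⟩ <;> nlinarith

/-- ★ **CELL-7: `rank B_{−m}(ℚ) = 0` and `Ш(B_{−m}/ℚ)[2] = 0`** for `m = pℓ`, `p ≡ 5 (mod 8)` prime, `ℓ ≡ 7 (mod 8)` prime with `x⁴ − 4x² + 2`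
rootless mod `ℓ` and `(p/ℓ) = +1` — UNCONDITIONAL (`two_pow_twoIsogenySelmerRank_add_eq` = AEC X.4.2(a) counted, with `#S, #S′ ≤ 2`, then
`forall_mem_sha_two_smul_eq_zero_of_halfModel` = AEC III.6.1). (Card data (e): 63/63 such prime twists clean.)
[cite: SilvermanAEC2009, Thm. X.4.2(a), Prop. X.4.9, Example X.4.10] -/
theorem rank_eq_zero_and_sha_two (hp : p.Prime) (hp8 : p % 8 = 5) (hℓ : ℓ.Prime) (hℓ8 : ℓ % 8 = 7)
    (hroot : ∀ x : ZMod ℓ, x ^ 4 - 4 * x ^ 2 + 2 ≠ 0) (hsq : IsSquare (p : ZMod ℓ)) (hm : m = p * ℓ) :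
    (⟨0, -4 * (m : ℚ), 0, 2 * (m : ℚ) ^ 2, 0⟩ : WeierstrassCurve ℚ).mordellWeilRank = 0 ∧
      ∀ c ∈ (⟨0, -4 * (m : ℚ), 0, 2 * (m : ℚ) ^ 2, 0⟩ : WeierstrassCurve ℚ).sha, 2 • c = 0 → c = 0 := by
  have hm0 : 0 < m := (pos_squarefree_odd hp hp8 hℓ hℓ8 hm).1
  have hab := hab_B hm0.ne'
  haveI := isElliptic_halfModel hab
  haveI := isElliptic_mk_of_ne_zero (F := ℚ) hab
  haveI := isElliptic_B hm0.ne'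
  have key := two_pow_twoIsogenySelmerRank_add_eq hab
  have h4 : 2 ^ (twoIsogenySelmerRank (-4 * m) (2 * m ^ 2) + twoIsogenySelmerRank' (-4 * m) (2 * m ^ 2)) ≤ 4 := by
    rw [pow_add, two_pow_twoIsogenySelmerRank_eq_card hab, two_pow_twoIsogenySelmerRank'_eq_card hab]
    exact Nat.mul_le_mul (card_twoIsogenySelmerGroup_le hp hp8 hℓ hℓ8 hroot hsq hm)
      (card_twoIsogenySelmerGroup'_le hp hp8 hℓ hℓ8 hroot hsq hm)
  rw [key] at h4
  obtain ⟨hr, h₁, h₂⟩ := rank_zero_arith h4 (by rw [← key]; exact pow_pos two_pos _)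
  have hsha := forall_mem_sha_two_smul_eq_zero_of_halfModel (AddSubgroup.eq_bot_of_card_eq _ h₁)
    (AddSubgroup.eq_bot_of_card_eq _ h₂)
  refine ⟨?_, forall_mem_sha_two_congr (lit_B m).symm hsha⟩
  rw [← mordellWeilRank_congr (lit_B m)]
  exact hr

/-- ★ **CELL-7, corank form: `corank_{ℤ₂} Sel_{2^∞}(B_{−m}/ℚ) = 0`** (same hypotheses; Greenberg's identity + `shaCorank_eq_zero_of_forall`).
The instance argument is `…SqrtTwoCell.isElliptic_B`. [cite: SilvermanAEC2009, Thm. X.4.2(a) and Prop. X.4.9] [cite: Greenberg1999, §1] -/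
theorem selmerCorank_two_eq_zero (hp : p.Prime) (hp8 : p % 8 = 5) (hℓ : ℓ.Prime) (hℓ8 : ℓ % 8 = 7)
    (hroot : ∀ x : ZMod ℓ, x ^ 4 - 4 * x ^ 2 + 2 ≠ 0) (hsq : IsSquare (p : ZMod ℓ)) (hm : m = p * ℓ)
    [hE : (⟨0, -4 * (m : ℚ), 0, 2 * (m : ℚ) ^ 2, 0⟩ : WeierstrassCurve ℚ).IsElliptic] :
    (⟨0, -4 * (m : ℚ), 0, 2 * (m : ℚ) ^ 2, 0⟩ : WeierstrassCurve ℚ).selmerCorank 2 = 0 := by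
  haveI : Fact (Nat.Prime 2) := ⟨Nat.prime_two⟩
  obtain ⟨hr, hsha⟩ := rank_eq_zero_and_sha_two hp hp8 hℓ hℓ8 hroot hsq hm
  rw [(⟨0, -4 * (m : ℚ), 0, 2 * (m : ℚ) ^ 2, 0⟩ : WeierstrassCurve ℚ).selmerCorank_eq_mordellWeilRank_add_holds 2, hr,
    (⟨0, -4 * (m : ℚ), 0, 2 * (m : ℚ) ^ 2, 0⟩ : WeierstrassCurve ℚ).shaCorank_eq_zero_of_forall 2 hsha]

end RankZero

end Summit.BirchSwinnertonDyer.BirchSwinnertonDyer.Theorems.BiquadraticEisensteinDescentHeegnerTwistCouplingInSupplySqrtTwoCellSeven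

end
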